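import Summits.Ventures.CertifiedManyBodySolver.Upper.BlochPlaquetteCells
import Literature.MathematicalPhysics.QuantumLattice.SlaterWindowReducedDensityMatrix
import HarnessLib

/-!
# Ventures/CertifiedManyBodySolver — Upper/BlochDressedPeriodic.lean

HONEST FRAMING: first certified bounds; not a superconductivity verdict; every number certified or labelled float.

CELL PERIODICITY OF THE PLAQUETTE-DRESSED SLATER FUNCTIONAL OF A BLOCH REFERENCE (sr-mbsolver L3 engine seat E1; step D3b of the
Lean route for the plaquette-dressed translation-invariant quasi-free uppers, eng-1/LEAN-GLUE-QF.md §4; theorem-only, nothing is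
claimed). On the torus `(ℤ/2m)²` with an even magnetic cell (`M i = 2 q i`, `k i · M i = 2m`) and a Bloch family `G σ κ`:
* `plaquetteWindow_eq_offset` — the `8 × 8` window block of `P_G = spinBlock (σ ↦ blochMatrix G_σ)` on the plaquette `c` is the
  explicit matrix `W₈(G; r)` of zeroth harmonics `|k|⁻¹ Σ_κ G σ κ` at the positions `a + 2r`, `r = c mod q`;
* `linkWindow_eq_offset` — the `16 × 16` window block on the link `(c, c + e_j)` is the explicit matrix `W₁₆(G; r, j)` of harmonics
  `|k|⁻¹ Σ_κ χ_κ(± e_j or 0) G σ κ` (the phase `e_j` exactly when the link crosses a cell face, `r_j + 1 = q_j`);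
* **`dressedFunctional_eq_card_mul_sum_offset`** — for a dressing that is periodic under the cell lattice (`u_c = v_{c mod q}`) the
  plaquette-dressed Slater functional `Σ_c ⟨u_cᴴ H_plaq u_c⟩_{ρ(P_G|c)} + Σ_{c,j} ⟨V_{c,j}ᴴ T_j V_{c,j}⟩_{ρ(P_G|c,c+e_j)}` of
  `PlaquetteLUC.groundEnergyAt_le_dressed` equals `|k| ·` the same expression summed over the `Π q i` offsets `r` only, with the
  windows `W₈(G; r)`, `W₁₆(G; r, j)` — a CELL quantity once the harmonics are cell data.
Sources: Bach–Lieb–Solovej 1994 eq. (3a.2) [BachLiebSolovej1994]. Everything is proved; no definition.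
-/

noncomputable section

namespace Summit.Ventures.CertifiedManyBodySolver.Upper

open Matrix Finset
open Literature.MathematicalPhysics.QuantumLattice Literature.MathematicalPhysics.QuantumLattice.HartreeFock HeisenbergTL HubbardWave0
  PlaquetteLUC
open scoped ComplexConjugate

variable {m : ℕ} [NeZero m] {k M : Fin 2 → ℕ} [∀ i, NeZero (k i)] [∀ i, NeZero (M i)] {q : Fin 2 → ℕ}

/-! ### §1. The window blocks depend on the plaquette only through its offset in the cell -/

/-- **The plaquette window block of a collinear Bloch one-body matrix** is the matrix of zeroth harmonics at the positions
`a + 2 (c mod q)`. [cite: BachLiebSolovej1994, eq. (3a.2)] -/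
theorem plaquetteWindow_eq_offset (hkM : ∀ i, k i * M i = m * 2) (hq : ∀ i, M i = 2 * q i)
    (G : Fin 2 → RectTorusSite k → Matrix (RectTorusSite M) (RectTorusSite M) ℂ) (c : Fin 2 → Fin m) :
    (spinBlock fun σ => blochMatrix hkM (G σ)).submatrix (fun a : Orb (FermionTorus 2 2) => orb (cellEmb c (ofLex a).1) (ofLex a).2)
        (fun a => orb (cellEmb c (ofLex a).1) (ofLex a).2) =
      Matrix.of fun o o' : Orb (FermionTorus 2 2) => if (ofLex o).2 = (ofLex o').2 then
        ((Fintype.card (RectTorusSite k) : ℂ))⁻¹ * ∑ κ, G (ofLex o).2 κ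
          (fun i => (((ofLex (ofLex o).1 i : ℕ) + 2 * ((c i : ℕ) % q i) : ℕ) : ZMod (M i)))
          (fun i => (((ofLex (ofLex o').1 i : ℕ) + 2 * ((c i : ℕ) % q i) : ℕ) : ZMod (M i))) else 0 := by
  ext o o'
  obtain ⟨a, σ, rfl⟩ := exists_eq_orb o
  obtain ⟨a', σ', rfl⟩ := exists_eq_orb o'
  simp only [Matrix.submatrix_apply, Matrix.of_apply, cellEmb_apply, orb, ofLex_toLex, spinBlock_orb]
  by_cases h : σ = σ'
  · subst h
    rw [if_pos rfl, if_pos rfl]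
    exact blochMatrix_cellSite_same hkM hq (G σ) c a a'
  · rw [if_neg h, if_neg h]

/-- **The link window block** `(c, c + e_j)`: harmonics with phase `χ_κ((β(b) - β(b')) e_j)`, `β(b) = [b = 1 ∧ r_j + 1 = q_j]`, at the
positions of the respective plaquettes (offsets `r` and `r + e_j mod q`). [cite: BachLiebSolovej1994, eq. (3a.2)] -/
theorem linkWindow_eq_offset (hkM : ∀ i, k i * M i = m * 2) (hq : ∀ i, M i = 2 * q i) (hm : 2 ≤ m)
    (G : Fin 2 → RectTorusSite k → Matrix (RectTorusSite M) (RectTorusSite M) ℂ) (c : Fin 2 → Fin m) (j : Fin 2) :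
    (spinBlock fun σ => blochMatrix hkM (G σ)).submatrix
        (fun a : Orb (Fin 2 ×ₗ FermionTorus 2 2) => orb (linkEmb hm c j (ofLex a).1) (ofLex a).2)
        (fun a => orb (linkEmb hm c j (ofLex a).1) (ofLex a).2) =
      Matrix.of fun o o' : Orb (Fin 2 ×ₗ FermionTorus 2 2) => if (ofLex o).2 = (ofLex o').2 then
        ((Fintype.card (RectTorusSite k) : ℂ))⁻¹ * ∑ κ, blockChar κ
          ((if (ofLex (ofLex o).1).1 = 0 then (0 : RectTorusSite k) else if (c j : ℕ) % q j + 1 < q j then 0 else Pi.single j 1) -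
            (if (ofLex (ofLex o').1).1 = 0 then (0 : RectTorusSite k) else if (c j : ℕ) % q j + 1 < q j then 0 else Pi.single j 1)) *
          G (ofLex o).2 κ
            (fun i => (((ofLex (ofLex (ofLex o).1).2 i : ℕ) + 2 * (if (ofLex (ofLex o).1).1 = 0 then (c i : ℕ) % q i else
              if i = j then ((c j : ℕ) + 1) % q j else (c i : ℕ) % q i) : ℕ) : ZMod (M i)))
            (fun i => (((ofLex (ofLex (ofLex o').1).2 i : ℕ) + 2 * (if (ofLex (ofLex o').1).1 = 0 then (c i : ℕ) % q i else
              if i = j then ((c j : ℕ) + 1) % q j else (c i : ℕ) % q i) : ℕ) : ZMod (M i))) else 0 := by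
  ext o o'
  obtain ⟨p, σ, rfl⟩ := exists_eq_orb o
  obtain ⟨p', σ', rfl⟩ := exists_eq_orb o'
  simp only [Matrix.submatrix_apply, Matrix.of_apply, orb, ofLex_toLex, spinBlock_orb]
  by_cases h : σ = σ'
  · subst h
    rw [if_pos rfl, if_pos rfl]
    exact blochMatrix_linkSite hkM hq hm (G σ) c j p p'
  · rw [if_neg h, if_neg h]

/-! ### §2. Periodic dressings: the cluster sums are `|k|` copies of the offset sums -/

/-- **Plaquette terms of a cell-periodic dressing.** If `u_c = v_{c mod q}` then
`Σ_c Σ_{s,s'} (u_cᴴ h u_c)_{ss'} ρ(P_G|c)(s,s') = |k| · Σ_r Σ_{s,s'} (v_rᴴ h v_r)_{ss'} ρ(W₈(G;r))(s,s')`, the sum over the offsets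
`r` (`r_i < q_i`). [cite: BachLiebSolovej1994, eq. (3a.2)] -/
theorem sum_plaquetteTerm_eq_card_mul_sum_offset (hkM : ∀ i, k i * M i = m * 2) (hq : ∀ i, M i = 2 * q i) (hq0 : ∀ i, 0 < q i)
    (G : Fin 2 → RectTorusSite k → Matrix (RectTorusSite M) (RectTorusSite M) ℂ)
    (h : Matrix (Finset (Orb (FermionTorus 2 2))) (Finset (Orb (FermionTorus 2 2))) ℂ)
    (u : (Fin 2 → Fin m) → Matrix (Finset (Orb (FermionTorus 2 2))) (Finset (Orb (FermionTorus 2 2))) ℂ)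
    (v : ((i : Fin 2) → Fin (q i)) → Matrix (Finset (Orb (FermionTorus 2 2))) (Finset (Orb (FermionTorus 2 2))) ℂ)
    (huv : ∀ c, u c = v (fun i => ⟨(c i : ℕ) % q i, Nat.mod_lt _ (hq0 i)⟩)) :
    ∑ c : Fin 2 → Fin m, ∑ s : Finset (Orb (FermionTorus 2 2)), ∑ s' : Finset (Orb (FermionTorus 2 2)),
        ((u c)ᴴ * h * u c) s s' * slaterRDM ((spinBlock fun σ => blochMatrix hkM (G σ)).submatrix
          (fun a : Orb (FermionTorus 2 2) => orb (cellEmb c (ofLex a).1) (ofLex a).2) (fun a => orb (cellEmb c (ofLex a).1) (ofLex a).2)) s s' =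
      (Fintype.card (RectTorusSite k) : ℂ) * ∑ r : (i : Fin 2) → Fin (q i), ∑ s : Finset (Orb (FermionTorus 2 2)),
        ∑ s' : Finset (Orb (FermionTorus 2 2)), ((v r)ᴴ * h * v r) s s' *
          slaterRDM (Matrix.of fun o o' : Orb (FermionTorus 2 2) => if (ofLex o).2 = (ofLex o').2 then
            ((Fintype.card (RectTorusSite k) : ℂ))⁻¹ * ∑ κ, G (ofLex o).2 κ
              (fun i => (((ofLex (ofLex o).1 i : ℕ) + 2 * (r i : ℕ) : ℕ) : ZMod (M i)))
              (fun i => (((ofLex (ofLex o').1 i : ℕ) + 2 * (r i : ℕ) : ℕ) : ZMod (M i))) else 0) s s' := by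
  classical
  -- the summand as a function of the offset
  obtain ⟨Φ, hΦ⟩ : ∃ Φ : (Fin 2 → ℕ) → ℂ, Φ = fun rN => ∑ s : Finset (Orb (FermionTorus 2 2)), ∑ s' : Finset (Orb (FermionTorus 2 2)),
      ((v (fun i => ⟨rN i % q i, Nat.mod_lt _ (hq0 i)⟩))ᴴ * h * v (fun i => ⟨rN i % q i, Nat.mod_lt _ (hq0 i)⟩)) s s' *
        slaterRDM (Matrix.of fun o o' : Orb (FermionTorus 2 2) => if (ofLex o).2 = (ofLex o').2 then
          ((Fintype.card (RectTorusSite k) : ℂ))⁻¹ * ∑ κ, G (ofLex o).2 κ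
            (fun i => (((ofLex (ofLex o).1 i : ℕ) + 2 * rN i : ℕ) : ZMod (M i)))
            (fun i => (((ofLex (ofLex o').1 i : ℕ) + 2 * rN i : ℕ) : ZMod (M i))) else 0) s s' := ⟨_, rfl⟩
  have hF : ∀ c : Fin 2 → Fin m, (∑ s : Finset (Orb (FermionTorus 2 2)), ∑ s' : Finset (Orb (FermionTorus 2 2)),
      ((u c)ᴴ * h * u c) s s' * slaterRDM ((spinBlock fun σ => blochMatrix hkM (G σ)).submatrix
        (fun a : Orb (FermionTorus 2 2) => orb (cellEmb c (ofLex a).1) (ofLex a).2) (fun a => orb (cellEmb c (ofLex a).1) (ofLex a).2)) s s') =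
      Φ (fun i => (c i : ℕ) % q i) := by
    intro c
    have harg : (fun i => (⟨(c i : ℕ) % q i, Nat.mod_lt _ (hq0 i)⟩ : Fin (q i))) =
        fun i => ⟨((c i : ℕ) % q i) % q i, Nat.mod_lt _ (hq0 i)⟩ := funext fun i => Fin.ext (Nat.mod_mod _ _).symm
    rw [hΦ, plaquetteWindow_eq_offset hkM hq G c, huv c, harg]
  rw [Finset.sum_congr rfl fun c _ => hF c, sum_plaquette_eq_card_mul_sum_offset (k := k) (fun i => k_mul_q_eq hkM hq i) Φ,
    nsmul_eq_mul]
  congr 1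
  refine Finset.sum_congr rfl fun r _ => ?_
  have harg : (fun i => (⟨(r i : ℕ) % q i, Nat.mod_lt _ (hq0 i)⟩ : Fin (q i))) = r :=
    funext fun i => Fin.ext (Nat.mod_eq_of_lt (Fin.isLt _))
  rw [hΦ]
  simp only [harg]

/-- **Link terms of a cell-periodic dressing.** If `u_c = v_{c mod q}` then the link terms of the plaquette-dressed functional sum to
`|k| ·` the sum over offsets `r` and directions `j` of the same terms with the gates `v_r`, `v_{r + e_j mod q}` and the explicit window
`W₁₆(G; r, j)`. [cite: BachLiebSolovej1994, eq. (3a.2)] -/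
theorem sum_linkTerm_eq_card_mul_sum_offset (hkM : ∀ i, k i * M i = m * 2) (hq : ∀ i, M i = 2 * q i) (hm : 2 ≤ m) (hq0 : ∀ i, 0 < q i)
    (G : Fin 2 → RectTorusSite k → Matrix (RectTorusSite M) (RectTorusSite M) ℂ)
    (T : Fin 2 → Matrix (Finset (Orb (Fin 2 ×ₗ FermionTorus 2 2))) (Finset (Orb (Fin 2 ×ₗ FermionTorus 2 2))) ℂ)
    (u : (Fin 2 → Fin m) → Matrix (Finset (Orb (FermionTorus 2 2))) (Finset (Orb (FermionTorus 2 2))) ℂ)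
    (v : ((i : Fin 2) → Fin (q i)) → Matrix (Finset (Orb (FermionTorus 2 2))) (Finset (Orb (FermionTorus 2 2))) ℂ)
    (huv : ∀ c, u c = v (fun i => ⟨(c i : ℕ) % q i, Nat.mod_lt _ (hq0 i)⟩)) :
    ∑ ℓ : (Fin 2 → Fin m) × Fin 2, ∑ s : Finset (Orb (Fin 2 ×ₗ FermionTorus 2 2)), ∑ s' : Finset (Orb (Fin 2 ×ₗ FermionTorus 2 2)),
        ((fermionEmbed inlCell (u ℓ.1) * fermionEmbed inrCell (u (shiftCell ℓ.1 ℓ.2)))ᴴ * T ℓ.2 *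
            (fermionEmbed inlCell (u ℓ.1) * fermionEmbed inrCell (u (shiftCell ℓ.1 ℓ.2)))) s s' *
          slaterRDM ((spinBlock fun σ => blochMatrix hkM (G σ)).submatrix
            (fun a : Orb (Fin 2 ×ₗ FermionTorus 2 2) => orb (linkEmb hm ℓ.1 ℓ.2 (ofLex a).1) (ofLex a).2)
            (fun a => orb (linkEmb hm ℓ.1 ℓ.2 (ofLex a).1) (ofLex a).2)) s s' =
      (Fintype.card (RectTorusSite k) : ℂ) * ∑ r : (i : Fin 2) → Fin (q i), ∑ j : Fin 2,
        ∑ s : Finset (Orb (Fin 2 ×ₗ FermionTorus 2 2)), ∑ s' : Finset (Orb (Fin 2 ×ₗ FermionTorus 2 2)),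
          ((fermionEmbed inlCell (v r) * fermionEmbed inrCell
                (v (fun i => ⟨(if i = j then (r i : ℕ) + 1 else (r i : ℕ)) % q i, Nat.mod_lt _ (hq0 i)⟩)))ᴴ * T j *
              (fermionEmbed inlCell (v r) * fermionEmbed inrCell
                (v (fun i => ⟨(if i = j then (r i : ℕ) + 1 else (r i : ℕ)) % q i, Nat.mod_lt _ (hq0 i)⟩)))) s s' *
            slaterRDM (Matrix.of fun o o' : Orb (Fin 2 ×ₗ FermionTorus 2 2) => if (ofLex o).2 = (ofLex o').2 then
              ((Fintype.card (RectTorusSite k) : ℂ))⁻¹ * ∑ κ, blockChar κ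
                ((if (ofLex (ofLex o).1).1 = 0 then (0 : RectTorusSite k) else if (r j : ℕ) + 1 < q j then 0 else Pi.single j 1) -
                  (if (ofLex (ofLex o').1).1 = 0 then (0 : RectTorusSite k) else if (r j : ℕ) + 1 < q j then 0 else Pi.single j 1)) *
                G (ofLex o).2 κ
                  (fun i => (((ofLex (ofLex (ofLex o).1).2 i : ℕ) + 2 * (if (ofLex (ofLex o).1).1 = 0 then (r i : ℕ) else
                    if i = j then ((r j : ℕ) + 1) % q j else (r i : ℕ)) : ℕ) : ZMod (M i)))
                  (fun i => (((ofLex (ofLex (ofLex o').1).2 i : ℕ) + 2 * (if (ofLex (ofLex o').1).1 = 0 then (r i : ℕ) else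
                    if i = j then ((r j : ℕ) + 1) % q j else (r i : ℕ)) : ℕ) : ZMod (M i))) else 0) s s' := by
  classical
  obtain ⟨Ψ, hΨ⟩ : ∃ Ψ : (Fin 2 → ℕ) → ℂ, Ψ = fun rN => ∑ j : Fin 2,
      ∑ s : Finset (Orb (Fin 2 ×ₗ FermionTorus 2 2)), ∑ s' : Finset (Orb (Fin 2 ×ₗ FermionTorus 2 2)),
        ((fermionEmbed inlCell (v (fun i => ⟨rN i % q i, Nat.mod_lt _ (hq0 i)⟩)) * fermionEmbed inrCell
              (v (fun i => ⟨(if i = j then rN i + 1 else rN i) % q i, Nat.mod_lt _ (hq0 i)⟩)))ᴴ * T j *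
            (fermionEmbed inlCell (v (fun i => ⟨rN i % q i, Nat.mod_lt _ (hq0 i)⟩)) * fermionEmbed inrCell
              (v (fun i => ⟨(if i = j then rN i + 1 else rN i) % q i, Nat.mod_lt _ (hq0 i)⟩)))) s s' *
          slaterRDM (Matrix.of fun o o' : Orb (Fin 2 ×ₗ FermionTorus 2 2) => if (ofLex o).2 = (ofLex o').2 then
            ((Fintype.card (RectTorusSite k) : ℂ))⁻¹ * ∑ κ, blockChar κ
              ((if (ofLex (ofLex o).1).1 = 0 then (0 : RectTorusSite k) else if rN j + 1 < q j then 0 else Pi.single j 1) -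
                (if (ofLex (ofLex o').1).1 = 0 then (0 : RectTorusSite k) else if rN j + 1 < q j then 0 else Pi.single j 1)) *
              G (ofLex o).2 κ
                (fun i => (((ofLex (ofLex (ofLex o).1).2 i : ℕ) + 2 * (if (ofLex (ofLex o).1).1 = 0 then rN i else
                  if i = j then (rN j + 1) % q j else rN i) : ℕ) : ZMod (M i)))
                (fun i => (((ofLex (ofLex (ofLex o').1).2 i : ℕ) + 2 * (if (ofLex (ofLex o').1).1 = 0 then rN i else
                  if i = j then (rN j + 1) % q j else rN i) : ℕ) : ZMod (M i))) else 0) s s' := ⟨_, rfl⟩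
  have hF : ∀ c : Fin 2 → Fin m, (∑ j : Fin 2, ∑ s : Finset (Orb (Fin 2 ×ₗ FermionTorus 2 2)),
      ∑ s' : Finset (Orb (Fin 2 ×ₗ FermionTorus 2 2)),
        ((fermionEmbed inlCell (u c) * fermionEmbed inrCell (u (shiftCell c j)))ᴴ * T j *
            (fermionEmbed inlCell (u c) * fermionEmbed inrCell (u (shiftCell c j)))) s s' *
          slaterRDM ((spinBlock fun σ => blochMatrix hkM (G σ)).submatrix
            (fun a : Orb (Fin 2 ×ₗ FermionTorus 2 2) => orb (linkEmb hm c j (ofLex a).1) (ofLex a).2)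
            (fun a => orb (linkEmb hm c j (ofLex a).1) (ofLex a).2)) s s') = Ψ (fun i => (c i : ℕ) % q i) := by
    intro c
    rw [hΨ]
    refine Finset.sum_congr rfl fun j _ => ?_
    have harg : (fun i => (⟨(c i : ℕ) % q i, Nat.mod_lt _ (hq0 i)⟩ : Fin (q i))) =
        fun i => ⟨((c i : ℕ) % q i) % q i, Nat.mod_lt _ (hq0 i)⟩ := funext fun i => Fin.ext (Nat.mod_mod _ _).symm
    have hargS : (fun i => (⟨(shiftCell c j i : ℕ) % q i, Nat.mod_lt _ (hq0 i)⟩ : Fin (q i))) =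
        fun i => ⟨(if i = j then (c i : ℕ) % q i + 1 else (c i : ℕ) % q i) % q i, Nat.mod_lt _ (hq0 i)⟩ := by
      funext i
      apply Fin.ext
      show (shiftCell c j i : ℕ) % q i = (if i = j then (c i : ℕ) % q i + 1 else (c i : ℕ) % q i) % q i
      rw [mod_shiftCell hkM hq hm]
      by_cases hij : i = j
      · subst hij; rw [if_pos rfl, if_pos rfl, Nat.mod_add_mod]
      · rw [if_neg hij, if_neg hij, Nat.mod_mod]
    have hmodj : ((c j : ℕ) + 1) % q j = ((c j : ℕ) % q j + 1) % q j := (Nat.mod_add_mod _ _ _).symm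
    rw [linkWindow_eq_offset hkM hq hm G c j, huv c, huv (shiftCell c j), harg, hargS, hmodj]
  rw [Fintype.sum_prod_type, Finset.sum_congr rfl fun c _ => hF c,
    sum_plaquette_eq_card_mul_sum_offset (k := k) (fun i => k_mul_q_eq hkM hq i) Ψ, nsmul_eq_mul]
  congr 1
  refine Finset.sum_congr rfl fun r _ => ?_
  have harg : (fun i => (⟨(r i : ℕ) % q i, Nat.mod_lt _ (hq0 i)⟩ : Fin (q i))) = r :=
    funext fun i => Fin.ext (Nat.mod_eq_of_lt (Fin.isLt _))
  rw [hΨ]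
  simp only [harg]

end Summit.Ventures.CertifiedManyBodySolver.Upper
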